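import Literature.RepresentationTheory.HeisenbergGroup.SchrodingerLerayJunction
import Literature.RepresentationTheory.HeisenbergGroup.ImplementerTransport
import Literature.RepresentationTheory.HeisenbergGroup.SymplecticMatrixTransport
import Literature.NumberTheory.Weil1964.LocalLerayCocycleTransport
import Literature.NumberTheory.Weil1964.LocalLerayCocycleChange
import HarnessLib

/-!
# Rao's Theorem 4.1 for the Schrödinger model of a Gram duality `⟨x, T y⟩` and an arbitrary Lagrangian

Topic `RepresentationTheory/HeisenbergGroup`; namespace `Literature.RepresentationTheory.HeisenbergGroup`. KERNEL
mathematics only (definitions with bodies + theorems; no named fact, no `axiom`, no `sorry`). Sequel of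
`SchrodingerLerayJunction.lean` (the junction `c_Schrödinger = c_Leray` for the standard duality `⟨x, y⟩`, the
Lagrangian `ℓ_Y = 0 ⊕ F^ι` and the self-dual measure).

Setting: `F` a non-archimedean local field with `2` invertible, `ψ` a non-trivial continuous character, `ι` finite,
`T ∈ M_ι(F)` with `det T` a unit, `W = F^ι × F^ι` with the duality `β_T(x, y) = ⟨x, T y⟩`
(Mathlib `Matrix.toLinearMap₂' F T` — the pairing of the tree's `UnitaryGroup.localPiToSymplectic`, of the global
`adelicSchrodinger` and of GR-1's `LocalUnitarySplittingDatum.localSchrodinger`), `ρ_T = schrodingerSB β_T ψ` the smooth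
Schrödinger model on `𝒮(F^ι)`, `A_T = alt (polar β_T)` Weil's symplectic form.

* §1 the isomorphism of Heisenberg data `e_T : (x, y) ↦ (x, T y)`, `(W, polar β_T) ≃ (W, polar ⟨·,·⟩)`
  (`gramProd`, `polar_dotProductBilin_gramProd`), under which **`ρ_T = ρ_1 ∘ e_T`** (`schrodingerSB_gram_eq`);
  hence (transport, `ImplementerTransport.lean`) **implementers of `ρ_T` are unique up to scalars and exist for
  every `g ∈ Sp(W, A_T)`** (`implementerUniqueUpToScalar_schrodingerSB_gram`, `existsImplementer_schrodingerSB_gram`;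
  [MoeglinVignerasWaldspurger1987] Chap. 2 II.1), and `A_T` is alternating and non-degenerate.
* §2 **RAO'S THEOREM 4.1 (5) / MVW Chap. 3 §I.3 AT THE DATUM `(ρ_T, ℓ)` FOR EVERY LAGRANGIAN `ℓ` OF `A_T` AND EVERY
  HAAR MEASURE `μ`**: there is a normalised section of implementers `r` of `ρ_T` whose cocycle IS the Leray cocycle
  `lerayCentralCocycle μ ψ(½·) A_T ℓ` (`exists_implementerSection_cocycle_eq_lerayCentralCocycle_gram`). Proof: the
  junction's Schrödinger–Leray section for `(⟨·,·⟩, ℓ_Y, μ₀)` with `μ₀` self-dual ([Rangarao1993] Thm 4.1); change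
  of Lagrangian `ℓ_Y → e_T ℓ` by twisting the section with the Lion–Vergne cochain `λ(g) = μ(e_Tℓ, g e_Tℓ, g ℓ_Y, ℓ_Y)⁻¹`
  ([LionVergne1980] 1.6.17, tree `lerayCentralCocycle_eq_twist` + `ImplementerSection.cocycle_twist_inv`);
  transport along `e_T` (`ImplementerSection.cocycle_transport`, `lerayCocycle_conj`); independence of the Haar
  measure (`lerayCocycle_eq_of_isAddHaarMeasure`). Consequently `MpPsi ρ_T ≃* LerayMetaplectic μ ψ(½·) A_T ℓ` over
  `Sp` and under `ℂˣ` is available through `ImplementerSection.twistedProductEquiv` (not restated).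
The `½` is Rao's: "`c_{X*}(σ₁, σ₂) = ` the Weil index of `x ↦ χ(½ q(x))`, `q` the Leray invariant" ([Rangarao1993]
Thm 4.1 (5), p. 358), i.e. the tree's Leray cocycle for the character `ψ(½·) = ψ.mulShift ⅟2`.

## References

* [Rangarao1993] R. Ranga Rao, *On some explicit formulas in the theory of Weil representation*, Pacific J. Math.
  157 (1993) 335–371: Thm 4.1 p. 358, §3.5.
* [MoeglinVignerasWaldspurger1987] C. Mœglin, M.-F. Vignéras, J.-L. Waldspurger, LNM 1291 (1987), Chap. 2 I.4,
  II.1, Chap. 3 §I.3.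
* [LionVergne1980] G. Lion, M. Vergne, Progress in Math. 6 (1980), §1.6.17–1.6.18.
* [Weil1964] A. Weil, Acta Math. 111 (1964), n° 5, n° 34.
-/

set_option autoImplicit false

noncomputable section

namespace Literature.RepresentationTheory.HeisenbergGroup

open _root_.MeasureTheory Matrix
open Literature.GroupTheory
open Literature.NumberTheory.Automorphic
open Literature.NumberTheory.GaloisRepresentations.IsNonarchimedeanLocalField
open Literature.NumberTheory.Weil1964
open Literature.LinearAlgebra.QuadraticForm

/-! ## §1 The isomorphism of Heisenberg data `(x, y) ↦ (x, T y)` and the model `ρ_T` -/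

section Gram

variable {F : Type*} [Field F] {ι : Type*} [Fintype ι] [DecidableEq ι] (T : Matrix ι ι F) (hT : IsUnit T.det)

local notation "𝕎" => ((ι → F) × (ι → F))

/-- **`e_T : (x, y) ↦ (x, T y)`**, a linear automorphism of `W = F^ι × F^ι` (`det T` a unit).
[cite: Weil1964, n° 34, p. 182] -/
def gramProd : 𝕎 ≃ₗ[F] 𝕎 := (LinearEquiv.refl F (ι → F)).prodCongr (SymplecticMatrix.gramEquiv T hT)

/-- formula. [cite: Weil1964, n° 34, p. 182] -/
@[simp] theorem gramProd_apply (v : 𝕎) : gramProd T hT v = (v.1, T *ᵥ v.2) := rfl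

/-- **`e_T` carries `polar β_T` to `polar ⟨·,·⟩`**: `⟨x, T y'⟩ = β_T(x, y')`.
[cite: Weil1964, n° 34, p. 182; MoeglinVignerasWaldspurger1987, Chap. 2 I.1] -/
theorem polar_dotProductBilin_gramProd (v w : 𝕎) :
    polar (dotProductBilin F F (m := ι)) (gramProd T hT v) (gramProd T hT w) = polar (Matrix.toLinearMap₂' F T) v w := by
  rw [polar_apply, polar_apply, gramProd_apply, gramProd_apply, dotProductBilin_apply_apply,
    Matrix.toLinearMap₂'_apply']

/-- … hence Weil's forms: `A_1(e_T v, e_T w) = A_T(v, w)`. [cite: Weil1964, n° 5, p. 150; n° 34, p. 182] -/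
theorem alt_polar_dotProductBilin_gramProd (v w : 𝕎) :
    alt (polar (dotProductBilin F F (m := ι))) (gramProd T hT v) (gramProd T hT w) =
      alt (polar (Matrix.toLinearMap₂' F T)) v w := by
  rw [alt_apply, alt_apply, polar_dotProductBilin_gramProd, polar_dotProductBilin_gramProd]

/-- `A_T` is alternating. [cite: Weil1964, n° 5, p. 150] -/
theorem isAlt_alt_polar_gram : (alt (polar (Matrix.toLinearMap₂' F T))).IsAlt := fun _ => sub_self _

include hT in
/-- `A_T` is non-degenerate (`det T` a unit): it is isometric to the standard form through `e_T`.
[cite: Weil1964, n° 5, p. 150; Rangarao1993, §2.1] -/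
theorem nondegenerate_alt_polar_gram : (alt (polar (Matrix.toLinearMap₂' F T))).Nondegenerate := by
  have hA := nondegenerate_alt_polar_dotProductBilin (F := F) (ι := ι)
  have hL : (alt (polar (Matrix.toLinearMap₂' F T))).SeparatingLeft := by
    intro v hv
    have h0 : gramProd T hT v = 0 := by
      refine (LinearMap.IsRefl.nondegenerate_iff_separatingLeft
        (isAlt_alt_polar_dotProductBilin (F := F) (ι := ι)).isRefl).1 hA _ fun w' => ?_
      have := hv ((gramProd T hT).symm w')
      rwa [← alt_polar_dotProductBilin_gramProd T hT, LinearEquiv.apply_symm_apply] at this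
    exact (gramProd T hT).map_eq_zero_iff.1 h0
  exact (LinearMap.IsRefl.nondegenerate_iff_separatingLeft (isAlt_alt_polar_gram T).isRefl).2 hL

variable [TopologicalSpace F] {ψ : AddChar F Circle} (hl : IsLocallyConstant (⇑ψ : F → Circle))
  (hb : ∀ y : ι → F, Continuous fun u : ι → F => dotProductBilin F F u y)
  (hbT : ∀ y : ι → F, Continuous fun u : ι → F => Matrix.toLinearMap₂' F T u y)
  [IsTopologicalAddGroup (ι → F)]

/-- **`ρ_T = ρ_1 ∘ e_T`**: the Schrödinger operator of `((x, y), t)` for the duality `β_T` is the Schrödinger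
operator of `((x, T y), t)` for the standard duality — the same formula `Φ ↦ ψ(t + ⟨u, T y⟩) Φ(u + x)`.
[cite: MoeglinVignerasWaldspurger1987, Chap. 2 I.4 Exemple (1); Weil1964, n° 34, p. 182] -/
theorem schrodingerSB_gram_eq (a : Heisenberg (polar (Matrix.toLinearMap₂' F T))) :
    schrodingerSB (Matrix.toLinearMap₂' F T) ψ hl hbT a =
      schrodingerSB (dotProductBilin F F (m := ι)) ψ hl hb
        (Heisenberg.mapEquiv (gramProd T hT) (polar_dotProductBilin_gramProd T hT) a) := by
  refine LinearMap.ext fun f => Subtype.ext (funext fun u => ?_)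
  rw [schrodingerSB_apply, schrodingerSB_apply, Heisenberg.mapEquiv_t, Heisenberg.mapEquiv_v, gramProd_apply,
    dotProductBilin_apply_apply, Matrix.toLinearMap₂'_apply']

end Gram

/-! ## §2 Implementers of `ρ_T`; Rao's theorem for `(ρ_T, ℓ)` -/

section LocalField

variable {F : Type*} [Field F] [ValuativeRel F] [TopologicalSpace F] [IsNonarchimedeanLocalField F]
  {ι : Type*} [Fintype ι] [DecidableEq ι] [Invertible (2 : F)] (T : Matrix ι ι F) (hT : IsUnit T.det)
  {ψ : AddChar F Circle} (hl : IsLocallyConstant (⇑ψ : F → Circle))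
  (hbT : ∀ y : ι → F, Continuous fun u : ι → F => Matrix.toLinearMap₂' F T u y)

local notation "𝕎" => ((ι → F) × (ι → F))
local notation "SpT" => (symplecticGroup (polar (Matrix.toLinearMap₂' F T)))
local notation "Sp1" => (symplecticGroup (polar (dotProductBilin F F (m := ι))))
local notation "ℓY" => (Submodule.prod (⊥ : Submodule F (ι → F)) (⊤ : Submodule F (ι → F)))
local notation "𝔸1" => (alt (polar (dotProductBilin F F (m := ι))))
local notation "𝔸T" => (alt (polar (Matrix.toLinearMap₂' F T)))

include hT in
/-- **implementers of `ρ_T` are unique up to scalars** (transport of `implementerUniqueUpToScalar_schrodingerSB_pi`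
along `e_T`). [cite: MoeglinVignerasWaldspurger1987, Chap. 2 II.1 (A) "M est unique à un scalaire près"] -/
theorem implementerUniqueUpToScalar_schrodingerSB_gram (hψ : ψ.IsContinuousNontrivial) :
    ImplementerUniqueUpToScalar (schrodingerSB (Matrix.toLinearMap₂' F T) ψ hl hbT) :=
  ImplementerUniqueUpToScalar.of_transport (gramProd T hT) (polar_dotProductBilin_gramProd T hT)
    (schrodingerSB_gram_eq T hT hl continuous_dotProductBilin_left hbT)
    (implementerUniqueUpToScalar_schrodingerSB_pi hl continuous_dotProductBilin_left hψ)

include hT in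
/-- **every `g ∈ Sp(W, A_T)` is implemented on `𝒮(F^ι)` for `ρ_T`** (transport of
`existsImplementer_schrodingerSB_pi`). [cite: MoeglinVignerasWaldspurger1987, Chap. 2 II.1 (A), II.6] -/
theorem existsImplementer_schrodingerSB_gram (hψ : ψ.IsContinuousNontrivial) :
    ExistsImplementer (schrodingerSB (Matrix.toLinearMap₂' F T) ψ hl hbT) :=
  ExistsImplementer.of_transport (gramProd T hT) (polar_dotProductBilin_gramProd T hT)
    (schrodingerSB_gram_eq T hT hl continuous_dotProductBilin_left hbT)
    (existsImplementer_schrodingerSB_pi hl continuous_dotProductBilin_left hψ)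

include hT in
/-- **`1 → ℂˣ → S̃p_ψ(W, β_T) → Sp(W, A_T) → 1` is a central extension** (MVW II.1 (B) for `ρ_T`).
[cite: MoeglinVignerasWaldspurger1987, Chap. 2 II.1 (B)] -/
theorem isCentralExt_schrodingerSB_gram (hψ : ψ.IsContinuousNontrivial) :
    Literature.RepresentationTheory.MoeglinVignerasWaldspurger1987.IsCentralExt (MpPsi.ofScalar (schrodingerSB (Matrix.toLinearMap₂' F T) ψ hl hbT))
      (MpPsi.proj (schrodingerSB (Matrix.toLinearMap₂' F T) ψ hl hbT)) :=
  isCentralExt_MpPsi _ (existsImplementer_schrodingerSB_gram T hT hl hbT hψ)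
    (implementerUniqueUpToScalar_schrodingerSB_gram T hT hl hbT hψ)

variable [MeasurableSpace F] [BorelSpace F] (μ : Measure F) [μ.IsAddHaarMeasure]

/-- **RAO'S THEOREM 4.1 (5) AT `(ρ_T, ℓ)`: for every Lagrangian `ℓ` of `(W, A_T)` and every Haar measure `μ` there
is a normalised section `r` of implementers of `ρ_T = schrodingerSB β_T ψ` on `𝒮(F^ι)` whose cocycle IS the Leray
cocycle of `ℓ` for the character `ψ(½·)`**: `r(g) r(g') = γ_{ψ(½·)}(τ(ℓ, gℓ, gg'ℓ)) · r(gg')` for all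
`g, g' ∈ Sp(W, A_T)`. [cite: Rangarao1993, Thm 4.1 (5), p. 358; MoeglinVignerasWaldspurger1987, Chap. 3 §I.3 Théorème; LionVergne1980, §1.6.17] -/
theorem exists_implementerSection_cocycle_eq_lerayCentralCocycle_gram (hψ : ψ.IsContinuousNontrivial)
    {ℓ : Submodule F 𝕎} (hℓ : LinearMap.BilinForm.orthogonal 𝔸T ℓ = ℓ) :
    ∃ r : ImplementerSection (schrodingerSB (Matrix.toLinearMap₂' F T) ψ hl hbT),
      r.cocycle (implementerUniqueUpToScalar_schrodingerSB_gram T hT hl hbT hψ) =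
        lerayCentralCocycle μ (isContinuousNontrivial_mulShift_half hψ) (isAlt_alt_polar_gram T)
          (nondegenerate_alt_polar_gram T hT) hℓ := by
  -- the data on the standard side
  set e := gramProd T hT with he
  have hpol := polar_dotProductBilin_gramProd T hT
  have hA : ∀ v w : 𝕎, 𝔸1 (e v) (e w) = 𝔸T v w := alt_polar_dotProductBilin_gramProd T hT
  have hb : ∀ y : ι → F, Continuous fun u : ι → F => dotProductBilin F F u y := continuous_dotProductBilin_left
  have hρ := schrodingerSB_gram_eq T hT hl hb hbT (ψ := ψ)
  have hψ' := isContinuousNontrivial_mulShift_half (F := F) hψ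
  have hU1 := implementerUniqueUpToScalar_schrodingerSB_pi hl hb hψ
  have hUT := implementerUniqueUpToScalar_schrodingerSB_gram T hT hl hbT hψ
  -- the image Lagrangian `ℓ' = e_T ℓ` of the standard form
  have hℓ' : LinearMap.BilinForm.orthogonal 𝔸1 (ℓ.map (e : 𝕎 →ₗ[F] 𝕎)) = ℓ.map (e : 𝕎 →ₗ[F] 𝕎) :=
    orthogonal_map_equiv_eq_self e hA hℓ
  -- a self-dual measure and the conductor of `ψ`; the junction's section for `(⟨·,·⟩, ℓ_Y, μ₀)`
  obtain ⟨m, hm⟩ := hψ.exists_hasConductorExp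
  obtain ⟨μ₀, hμ₀, hsd⟩ := exists_isSelfDualMeasure hψ
  haveI := hμ₀
  set r₀ := schrodingerLerayImplementerSection hl hb μ₀ hψ hm hsd with hr₀
  have h₀ : r₀.cocycle hU1 = lerayCentralCocycle μ₀ hψ' (isAlt_alt_polar_dotProductBilin (F := F) (ι := ι))
      nondegenerate_alt_polar_dotProductBilin orthogonal_prod_bot_top :=
    schrodingerCocyclePi_eq_lerayCentralCocycle hl hb μ₀ hψ hm hsd
  -- change of Lagrangian `ℓ_Y → ℓ'` by twisting with the Lion–Vergne cochain `λ = μ(ℓ', gℓ', gℓ_Y, ℓ_Y)⁻¹`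
  have hlam1 : lerayCochain μ₀ hψ' 𝔸1 (ℓ.map (e : 𝕎 →ₗ[F] 𝕎)) ℓY 1 = 1 :=
    lerayCochain_one μ₀ hψ' 𝔸1 (isotropic_of_orthogonal_eq_self hℓ') (isotropic_of_orthogonal_eq_self orthogonal_prod_bot_top)
  -- the same normalisation read on `Sp(W, A_1) = symplecticGroup (polar ⟨·,·⟩)` (definitionally `isometries A_1`)
  have hlam1' : (lerayCochain μ₀ hψ' 𝔸1 (ℓ.map (e : 𝕎 →ₗ[F] 𝕎)) ℓY (1 : Sp1))⁻¹ = 1 := by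
    rw [show lerayCochain μ₀ hψ' 𝔸1 (ℓ.map (e : 𝕎 →ₗ[F] 𝕎)) ℓY (1 : Sp1) = 1 from hlam1, inv_one]
  have h₁ : (r₀.twist (fun g => (lerayCochain μ₀ hψ' 𝔸1 (ℓ.map (e : 𝕎 →ₗ[F] 𝕎)) ℓY g)⁻¹) hlam1').cocycle
      hU1 = lerayCentralCocycle μ₀ hψ' (isAlt_alt_polar_dotProductBilin (F := F) (ι := ι))
        nondegenerate_alt_polar_dotProductBilin hℓ' := by
    rw [ImplementerSection.cocycle_twist_inv r₀ hU1 _ hlam1, h₀]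
    exact (lerayCentralCocycle_eq_twist μ₀ hψ' isAlt_alt_polar_dotProductBilin nondegenerate_alt_polar_dotProductBilin
      hℓ' orthogonal_prod_bot_top).symm
  -- transport along `e_T` and Haar independence
  refine ⟨ImplementerSection.transport e hpol hρ
    (r₀.twist (fun g => (lerayCochain μ₀ hψ' 𝔸1 (ℓ.map (e : 𝕎 →ₗ[F] 𝕎)) ℓY g)⁻¹) hlam1'),
    CentralCocycle.ext fun g g' => Units.ext ?_⟩
  rw [ImplementerSection.cocycle_transport e hpol hρ _ hUT hU1, h₁]
  change lerayCocycle (ψ.mulShift (⅟(2 : F))) μ₀ 𝔸1 (ℓ.map (e : 𝕎 →ₗ[F] 𝕎))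
      ((symplecticConj e hpol g : Sp1) : 𝕎 ≃ₗ[F] 𝕎) ((symplecticConj e hpol g' : Sp1) : 𝕎 ≃ₗ[F] 𝕎) =
    lerayCocycle (ψ.mulShift (⅟(2 : F))) μ 𝔸T ℓ (g : 𝕎 ≃ₗ[F] 𝕎) (g' : 𝕎 ≃ₗ[F] 𝕎)
  rw [coe_symplecticConj, coe_symplecticConj, lerayCocycle_conj μ₀ e hA hψ', lerayCocycle_eq_of_isAddHaarMeasure μ μ₀ hψ']

include hT in
/-- the same with the uniqueness witness existentially bound (the shape consumed by
`GelbartRogawski1991/LocalUnitarySplittingDatum.LocalSplittingDatum`: fields `hU`, `r`, `cocycle_eq`).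
[cite: Rangarao1993, Thm 4.1 (5), p. 358; MoeglinVignerasWaldspurger1987, Chap. 3 §I.3] -/
theorem exists_hU_implementerSection_cocycle_eq_lerayCentralCocycle_gram (hψ : ψ.IsContinuousNontrivial)
    {ℓ : Submodule F 𝕎} (hℓ : LinearMap.BilinForm.orthogonal 𝔸T ℓ = ℓ)
    (hA : LinearMap.IsAlt 𝔸T) (hN : LinearMap.BilinForm.Nondegenerate 𝔸T) :
    ∃ (hU : ImplementerUniqueUpToScalar (schrodingerSB (Matrix.toLinearMap₂' F T) ψ hl hbT))
      (r : ImplementerSection (schrodingerSB (Matrix.toLinearMap₂' F T) ψ hl hbT)),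
      ∀ g g' : SpT, r.cocycle hU g g' = lerayCentralCocycle μ (isContinuousNontrivial_mulShift_half hψ) hA hN hℓ g g' := by
  obtain ⟨r, hr⟩ := exists_implementerSection_cocycle_eq_lerayCentralCocycle_gram T hT hl hbT μ hψ hℓ
  exact ⟨implementerUniqueUpToScalar_schrodingerSB_gram T hT hl hbT hψ, r, fun g g' => by rw [hr]; rfl⟩

end LocalField

end Literature.RepresentationTheory.HeisenbergGroup
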